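/-
Origin: expansion seat `planner-pub-hodgecm-prl1-g6-0`, handover #1 2026-08-18T12:40:49Z (md5 cf1d2c24; RENAMED at landing AllChars -> SignRecipeEndStateAllChars; imports tree modules only, no rewrite) (`HOME/pub-hodgecm-prl1-g6/lean/Prl1g6/AllChars.lean`, md5 cf1d2c24, 501 lines);
landed by the gen-8 packager in gate run 29 as `HodgeCM/Automorphic/SignRecipeEndStateAllChars.lean` (verbatim).
-/
/-
Copyright: pub-hodgecm formalisation cell (harness21, 2026). New file (not vendored).
Origin: HOME/pub-hodgecm-prl1-g6/lean/Prl1g6/AllChars.lean — session planner-pub-hodgecm-prl1-g6-0 (unit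
pub-hodgecm-prl1-g6, EXPANSION PROVER a-1, gen 6, STRATEGY 1 = CONSTRUCT).  Intended final place:
`HodgeCM/Automorphic/SignRecipeEndStateAllChars.lean` (ONE NEW FILE, additive leaf; nothing imports it).
-/
import Summits.HodgeConjecture.HodgeCM.Automorphic.SignRecipeEndStateFree
import Summits.HodgeConjecture.HodgeCM.Assembly.CorCMEndState

set_option autoImplicit false

/-!
# END STATE of part (a) with the `chars` input ELIMINATED — every character of type `w` allowed

Run-28 END STATE of record (`HodgeCM.Assembly.realisationExists_ofSignRecipe₀`,
`HodgeCM/Automorphic/SignRecipeEndStateFree.lean`):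

  `RealisationExistsPerL ∧ RealisationExistsFace ⇐ M ∧ (C.thetaModel h d12 d34).NonDesignInputs ∧ Fact_hodgeRiemann20`,

EIGHT non-design theta inputs: `embCover`, `innerEmb` [PRINT], `thetaSub` (N12), `thetaWedge` (N33), `thetaGen12`
(N19w), `thetaReal34` (N19g), `chars` (N31 = PerL v5 Lemma 4.2(b)), `occ` (N29).

THIS FILE (STRATEGY 1, CONSTRUCT): the allowed-pair predicate of PerL Def 3.2 — the field
`Perl34.TorusData.allowed : X → Prop`, the only place where "`χ` arises from an allowed pair" enters the typed
chain: in STATEMENTS it occurs in `TorusData.S12_def`, in the hypothesis of `Open_thetaReal34`, in `Open_chars` and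
in the output field `ThetaRealisation.real34`; inside the KERNEL proofs it is read by the prior programme's Prop 3.6
Step 1 / Thm 3.7 (`Perl34.IsolationSetting.H_chars12/34`, `C1_prop36 (hch)`, `SfullC_le_S12 (hch)`: `𝒯_Φ(E^χ_f) ∈ S₁₂`
needs `χ` allowed, PerL ll. 374–375), fed from `Open_chars` in `Proofs.RealisationConstruction` — is INSTANTIATED by
`fun _ => True` ("every character of `[T]` of archimedean type `w` is allowed"):
`TorusData.allChars`, `ThetaModel.allChars`.  For the resulting model the input `Open_chars` is a THEOREM
(`ThetaModel.allChars_chars`, proof `trivial`), so the END STATE has SEVEN non-design inputs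
(`ThetaModel.AllCharsNonDesign`): the five inputs `embCover`, `innerEmb`, `thetaSub`, `thetaWedge`, `occ`
VERBATIM, and the two torus-side inputs in their all-characters form

* `Open_thetaGen12All` — N19w with `S₁₂` replaced by `S₁₂^all := closure (span {ϑ_{T,χ}(Φ) : ALL χ of type w, Φ})`
  (a LARGER target space: `TorusData.S12_le_allChars`), and
* `Open_thetaReal34All` — N19g for EVERY character `χ` of `[T']` of type `w'` (not only the allowed ones).

MONOTONICITY (`ThetaModel.NonDesignInputs.allChars`, kernel-checked): for EVERY theta model `T` (whatever its
`allowed` predicates) the eight inputs of record IMPLY the seven all-characters inputs — `thetaGen12All` from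
`thetaGen12` by `S₁₂ ≤ S₁₂^all`, `thetaReal34All` from `thetaReal34 ∧ chars`, the other five unchanged.  Hence the
new END STATE `Assembly.realisationExists_ofSignRecipe₇` is a FREE WEAKENING of the hypotheses of the END STATE of
record, which is re-derived from it (`Assembly.realisationExists_ofSignRecipe₀_of₇`); no hypothesis is strengthened.

HONEST READING (what left the cone and what did not).  `Open_chars` = PerL v5 Lemma 4.2(b) (tex ll. 527–638) =
hypothesis `H_chars` of Prop 3.6 / Thm 3.7: "every character of type `w` (resp. `w'`) arises from an allowed pair",
allowed = Def 3.2 (ll. 269–279): (α) theta-space non-vanishing `Θ_{φ}(χ′) ≠ 0` for SOME `φ` (Rallis inner product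
formula [GQT §11.3], [Li92 Thm 2.1], local non-vanishing / ε-dichotomy [HKS (1.14)–(1.15)]) AND (β) "all constituents
of the lift lie in `𝒜^{1,0}`".  In the typed chain `allowed` is an ABSTRACT predicate consumed only through
`S12_def` and the two hypotheses above, and the conclusion `RealisationExistsPerL ∧ RealisationExistsFace` asks for
SOME `ThetaRealisation` — whose `S₁₂` may be `S₁₂^all`.  So:
* the ANALYTIC half (α) of N31 for EVERY character (LEMMAS.md N31a–g, N31h(i)) is consumed NOWHERE in the cone of
  part (a) — it is eliminated, not relocated;
* SUPPLY (Lemma 4.2(a): existence of allowed pairs with `θ_φ(χ′) ≠ 0`) was and stays inside `Open_thetaWedge` (N33);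
* the (β)-type content stays load-bearing exactly where it is consumed: `Open_thetaSub` (N12: theta one-forms are
  `B_Ψ`-isotypic holomorphic) and `Open_thetaReal34All` (N19g now for ALL characters of type `w'`: every generator
  `ϑ_{T',χ}(Φ)` is a limit of wedge-functions of theta one-forms).  This is the cell's recorded caveat (GAPS.md
  prl2g2-X1 2026-08-18T04:09Z "typed shadow `allowed := fun _ => True`"; carverg2 verdict l. 1464 "(β) = N31h(ii)
  stays"; LEMMAS.md §1 N25/N31, §10) — here made a kernel theorem with its exact price: NONE relative to the END
  STATE of record (monotonicity), the (β)-content being charged to N19g-for-all-χ instead of to N31 ∧ N19g-for-allowed-χ.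
* Divergence from PerL-as-written: PerL v5 defines `S₁₂` over allowed pairs (ll. 348–349); the realisation built
  here uses `S₁₂^all ⊇ S₁₂`.  `S₁₂` is an intermediate object of the proof, not part of the adjudicated statements.

Also recorded: for a theta model all of whose characters are allowed the eight inputs of record and the seven
all-characters inputs are EQUIVALENT (`nonDesignInputs_iff_allChars_of_allowed`); the END STATE over archimedean
types only (`AdelicThetaCore.thetaModelArch`: per context and side the DATA is the pair `(m₁, m₂)` and nothing else).

PROVED; closure = {propext, Classical.choice, Quot.sound}.  No new cited fact, no new model fact.
-/

noncomputable section

open scoped InnerProductSpace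
open NumberField

namespace HodgeCM

/-! ## Torus data with every character allowed -/

namespace Prior.Perl34File.Perl34.TorusData

variable {H HG CG G SK SigIdx SigIdxG : Type*}
variable [NormedAddCommGroup H] [InnerProductSpace ℂ H] [CompleteSpace H]
variable [NormedAddCommGroup HG] [InnerProductSpace ℂ HG] [CompleteSpace HG]
variable [NormedAddCommGroup CG] [NormedSpace ℂ CG]
variable [Group G] [TopologicalSpace G] [TopologicalSpace SK]
variable {C : IsolationCore H HG CG G SK SigIdx SigIdxG} (D : TorusData C)

/-- **The same torus data with EVERY character of type `w` allowed**: `allowed := fun _ => True` and, forced by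
`S12_def`, `S₁₂ := S₁₂^all = closure (span {ϑ_{T,χ}(Φ) : χ ∈ X, Φ ∈ 𝒮^κ})`; all other fields (characters `X`, theta
integrals `ϑc`, pseudo-Eisenstein vectors, `wOccurs`, `P_w`, AX5b/AX8/AX9/AX12) VERBATIM. -/
def allChars : TorusData C :=
  { D with
    allowed := fun _ => True
    S12 := (Submodule.span ℂ {u : HG | ∃ χ : D.X, True ∧ ∃ Φ : SK, u = C.inclCG (D.ϑc χ Φ)}).topologicalClosure
    S12_def := rfl }

/-- (Ported verbatim from the HodgeCMPerL package; no docstring in the source.) -/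
@[simp] theorem allChars_X : D.allChars.X = D.X := rfl

/-- (Ported verbatim from the HodgeCMPerL package; no docstring in the source.) -/
@[simp] theorem allChars_allowed (χ : D.X) : D.allChars.allowed χ ↔ True := Iff.rfl

/-- (Ported verbatim from the HodgeCMPerL package; no docstring in the source.) -/
theorem allChars_ϑc : D.allChars.ϑc = D.ϑc := rfl

/-- (Ported verbatim from the HodgeCMPerL package; no docstring in the source.) -/
theorem allChars_ϑ (χ : D.X) (Φ : SK) : D.allChars.ϑ χ Φ = D.ϑ χ Φ := rfl

/-- (Ported verbatim from the HodgeCMPerL package; no docstring in the source.) -/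
@[simp] theorem allChars_wOccurs : D.allChars.wOccurs = D.wOccurs := rfl

/-- (Ported verbatim from the HodgeCMPerL package; no docstring in the source.) -/
@[simp] theorem allChars_Pw : D.allChars.Pw = D.Pw := rfl

/-- (Ported verbatim from the HodgeCMPerL package; no docstring in the source.) -/
@[simp] theorem allChars_E : D.allChars.E = D.E := rfl

/-- `S₁₂^all`. -/
theorem allChars_S12 : D.allChars.S12 =
    (Submodule.span ℂ {u : HG | ∃ (χ : D.X) (Φ : SK), u = D.ϑ χ Φ}).topologicalClosure := by
  simp only [allChars, TorusData.ϑ, true_and]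

/-- **`S₁₂ ≤ S₁₂^all`** (the only effect of forgetting the allowed-pair predicate on the (12) side). -/
theorem S12_le_allChars : D.S12 ≤ D.allChars.S12 := by
  rw [D.S12_def, allChars_S12]
  exact Submodule.topologicalClosure_mono (Submodule.span_mono fun u ⟨χ, _, Φ, hu⟩ => ⟨χ, Φ, hu⟩)

/-- If every character is allowed already, `S₁₂ = S₁₂^all`. -/
theorem S12_eq_allChars (h : ∀ χ : D.X, D.allowed χ) : D.S12 = D.allChars.S12 := by
  rw [D.S12_def, allChars_S12]
  congr 1
  apply le_antisymm
  · exact Submodule.span_mono fun u ⟨χ, _, Φ, hu⟩ => ⟨χ, Φ, hu⟩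
  · exact Submodule.span_mono fun u ⟨χ, Φ, hu⟩ => ⟨χ, h χ, Φ, hu⟩

/-- (Ported verbatim from the HodgeCMPerL package; no docstring in the source.) -/
theorem allChars_allChars : D.allChars.allChars = D.allChars := rfl

end Prior.Perl34File.Perl34.TorusData

/-! ## The theta model with every character allowed -/

namespace Universe

open HodgeCM.Prior.Perl34File HodgeCM.Prior.Perl34File.Perl34 HodgeCM.PerL34

variable {U : Universe}

namespace ThetaModel

variable (T : U.ThetaModel)

/-- **The theta model `T` with every character of type `w` / `w'` allowed** on both torus sides (all other
primitives — `HG`, `emb`, `cover`, `kappa`, `frameSign`, the cores, the theta one-forms — VERBATIM). -/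
def allChars : U.ThetaModel :=
  { T with
    t12 := fun V c => (T.t12 V c).allChars
    t34 := fun V c => (T.t34 V c).allChars }

/-- (Ported verbatim from the HodgeCMPerL package; no docstring in the source.) -/
theorem allChars_t12 {L : CMField} {ι₁ : L →+* ℂ} (V : HermSpace3 L ι₁) (c : SeesawCtx L) :
    T.allChars.t12 V c = (T.t12 V c).allChars := rfl

/-- (Ported verbatim from the HodgeCMPerL package; no docstring in the source.) -/
theorem allChars_t34 {L : CMField} {ι₁ : L →+* ℂ} (V : HermSpace3 L ι₁) (c : SeesawCtx L) :
    T.allChars.t34 V c = (T.t34 V c).allChars := rfl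

/-- (Ported verbatim from the HodgeCMPerL package; no docstring in the source.) -/
theorem allChars_kappa : T.allChars.kappa = T.kappa := rfl

/-- (Ported verbatim from the HodgeCMPerL package; no docstring in the source.) -/
theorem allChars_frameSign : T.allChars.frameSign = T.frameSign := rfl

/-- (Ported verbatim from the HodgeCMPerL package; no docstring in the source.) -/
theorem allChars_Theta {L : CMField} {ι₁ : L →+* ℂ} (V : HermSpace3 L ι₁) (c : SeesawCtx L) (i : Fin 4)
    (Γ : Level V) : T.allChars.Theta V c i Γ = T.Theta V c i Γ := rfl

/-- (Ported verbatim from the HodgeCMPerL package; no docstring in the source.) -/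
theorem allChars_Λ {L : CMField} {ι₁ : L →+* ℂ} {V : HermSpace3 L ι₁} (Γ : Level V) :
    T.allChars.Λ Γ = T.Λ Γ := rfl

/-- (Ported verbatim from the HodgeCMPerL package; no docstring in the source.) -/
theorem allChars_wedgeSet {L : CMField} {ι₁ : L →+* ℂ} (V : HermSpace3 L ι₁) (c : SeesawCtx L) (k l : Fin 4) :
    T.allChars.wedgeSet V c k l = T.wedgeSet V c k l := rfl

/-- (Ported verbatim from the HodgeCMPerL package; no docstring in the source.) -/
theorem allChars_goodCtx_iff {L : CMField} (ι₁ : L →+* ℂ) (c : SeesawCtx L) :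
    T.allChars.GoodCtx ι₁ c ↔ T.GoodCtx ι₁ c :=
  ⟨fun ⟨h1, h2, h3, h4⟩ => ⟨h1, h2, h3, h4⟩, fun ⟨h1, h2, h3, h4⟩ => ⟨h1, h2, h3, h4⟩⟩

/-- (Ported verbatim from the HodgeCMPerL package; no docstring in the source.) -/
theorem allChars_allChars : T.allChars.allChars = T.allChars := rfl

/-! ### The two torus-side inputs in all-characters form -/

/-- **N19w for `S₁₂^all`** (PerL Lemma 3.5, seesaw direction, pair (12)): in a good context the `L²` function of
the wedge of theta one-forms of types `Ψ₀, Ψ₁` lies in the closed span of ALL generators `ϑ_{T,χ}(Φ)`, `χ` of type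
`w` — the statement `Open_thetaGen12` with the (larger) target `S₁₂^all ⊇ S₁₂`. -/
def Open_thetaGen12All : Prop :=
  ∀ {L : CMField} {ι₁ : L →+* ℂ} (V : HermSpace3 L ι₁) (c : SeesawCtx L), T.GoodCtx ι₁ c →
    ∀ (Γ : Level V) (ω₁ ω₂ : U.CohC (U.pms L ι₁ V Γ) 1), ω₁ ∈ T.Theta V c 0 Γ → ω₂ ∈ T.Theta V c 1 Γ →
      T.Λ Γ ω₁ ω₂ ∈ (Submodule.span ℂ
        {u : T.HG L ι₁ V | ∃ (χ : (T.t12 V c).X) (Φ : T.SK V c), u = (T.t12 V c).ϑ χ Φ}).topologicalClosure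

/-- **N19g for EVERY character of type `w'`** (PerL Lemma 3.5, generation direction, pair (34), closure form):
the statement `Open_thetaReal34` without its hypothesis `(T.t34 V c).allowed χ`. -/
def Open_thetaReal34All : Prop :=
  ∀ {L : CMField} {ι₁ : L →+* ℂ} (V : HermSpace3 L ι₁) (c : SeesawCtx L), T.GoodCtx ι₁ c →
    ∀ (χ : (T.t34 V c).X) (Φ : T.SK V c),
      (T.t34 V c).ϑ χ Φ ∈ (Submodule.span ℂ (T.wedgeSet V c 2 3)).topologicalClosure

/-! ### The ten named propositions of `T.allChars` versus those of `T` -/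

/-- (Ported verbatim from the HodgeCMPerL package; no docstring in the source.) -/
theorem allChars_embCover_iff : T.allChars.Fact_embCover ↔ T.Fact_embCover := Iff.rfl

/-- (Ported verbatim from the HodgeCMPerL package; no docstring in the source.) -/
theorem allChars_innerEmb_iff : T.allChars.Fact_innerEmb ↔ T.Fact_innerEmb := Iff.rfl

/-- (Ported verbatim from the HodgeCMPerL package; no docstring in the source.) -/
theorem allChars_kappaConj_iff : T.allChars.Design_kappaConj ↔ T.Design_kappaConj := Iff.rfl

/-- (Ported verbatim from the HodgeCMPerL package; no docstring in the source.) -/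
theorem allChars_frameSignConj_iff : T.allChars.Design_frameSignConj ↔ T.Design_frameSignConj := Iff.rfl

/-- (Ported verbatim from the HodgeCMPerL package; no docstring in the source.) -/
theorem allChars_thetaSub_iff : T.allChars.Open_thetaSub ↔ T.Open_thetaSub :=
  ⟨fun h _ ι₁ V c hc => h V c ((T.allChars_goodCtx_iff ι₁ c).mpr hc),
    fun h _ ι₁ V c hc => h V c ((T.allChars_goodCtx_iff ι₁ c).mp hc)⟩

/-- (Ported verbatim from the HodgeCMPerL package; no docstring in the source.) -/
theorem allChars_thetaWedge_iff : T.allChars.Open_thetaWedge ↔ T.Open_thetaWedge :=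
  ⟨fun h _ ι₁ V c hc => h V c ((T.allChars_goodCtx_iff ι₁ c).mpr hc),
    fun h _ ι₁ V c hc => h V c ((T.allChars_goodCtx_iff ι₁ c).mp hc)⟩

/-- (Ported verbatim from the HodgeCMPerL package; no docstring in the source.) -/
theorem allChars_occ_iff : T.allChars.Open_occ ↔ T.Open_occ :=
  ⟨fun h _ ι₁ V c hc => h V c ((T.allChars_goodCtx_iff ι₁ c).mpr hc),
    fun h _ ι₁ V c hc => h V c ((T.allChars_goodCtx_iff ι₁ c).mp hc)⟩

/-- `Open_thetaGen12` of `T.allChars` IS N19w for `S₁₂^all`. -/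
theorem allChars_thetaGen12_iff : T.allChars.Open_thetaGen12 ↔ T.Open_thetaGen12All := by
  constructor
  · intro h L ι₁ V c hc Γ ω₁ ω₂ h₁ h₂
    have h' : T.Λ Γ ω₁ ω₂ ∈ (T.t12 V c).allChars.S12 :=
      h V c ((T.allChars_goodCtx_iff ι₁ c).mpr hc) Γ ω₁ ω₂ h₁ h₂
    rwa [TorusData.allChars_S12] at h'
  · intro h L ι₁ V c hc Γ ω₁ ω₂ h₁ h₂
    show T.Λ Γ ω₁ ω₂ ∈ (T.t12 V c).allChars.S12
    rw [TorusData.allChars_S12]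
    exact h V c ((T.allChars_goodCtx_iff ι₁ c).mp hc) Γ ω₁ ω₂ h₁ h₂

/-- `Open_thetaReal34` of `T.allChars` IS N19g for every character. -/
theorem allChars_thetaReal34_iff : T.allChars.Open_thetaReal34 ↔ T.Open_thetaReal34All :=
  ⟨fun h _ ι₁ V c hc χ Φ => h V c ((T.allChars_goodCtx_iff ι₁ c).mpr hc) χ trivial Φ,
    fun h _ ι₁ V c hc χ _ Φ => h V c ((T.allChars_goodCtx_iff ι₁ c).mp hc) χ Φ⟩

/-- **`Open_chars` (N31 = PerL Lemma 4.2(b)) holds for `T.allChars` — by `trivial`.** -/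
theorem allChars_chars : T.allChars.Open_chars := by
  intro L ι₁ V c _
  exact ⟨fun _ => trivial, fun _ => trivial⟩

/-! ### Monotonicity: the inputs of record imply the all-characters inputs -/

/-- N19w ⟹ N19w for `S₁₂^all` (`S₁₂ ≤ S₁₂^all`). -/
theorem thetaGen12All_of (h : T.Open_thetaGen12) : T.Open_thetaGen12All := by
  intro L ι₁ V c hc Γ ω₁ ω₂ h₁ h₂
  have h' := (T.t12 V c).S12_le_allChars (h V c hc Γ ω₁ ω₂ h₁ h₂)
  rwa [TorusData.allChars_S12] at h'

/-- N19g (allowed characters) ∧ N31 ⟹ N19g for every character. -/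
theorem thetaReal34All_of (h : T.Open_thetaReal34) (hch : T.Open_chars) : T.Open_thetaReal34All :=
  fun V c hc χ Φ => h V c hc χ ((hch V c hc).2 χ) Φ

/-- Conversely N19g for every character ⟹ N19g. -/
theorem thetaReal34_of_all (h : T.Open_thetaReal34All) : T.Open_thetaReal34 :=
  fun V c hc χ _ Φ => h V c hc χ Φ

/-- Under N31 the two forms of N19g coincide. -/
theorem thetaReal34All_iff_of_chars (hch : T.Open_chars) : T.Open_thetaReal34All ↔ T.Open_thetaReal34 :=
  ⟨T.thetaReal34_of_all, fun h => T.thetaReal34All_of h hch⟩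

/-- If every (12)-character of `T` is allowed, the two forms of N19w coincide (`S₁₂ = S₁₂^all`). -/
theorem thetaGen12All_iff_of_allowed
    (h12 : ∀ {L : CMField} {ι₁ : L →+* ℂ} (V : HermSpace3 L ι₁) (c : SeesawCtx L) (χ : (T.t12 V c).X),
      (T.t12 V c).allowed χ) :
    T.Open_thetaGen12All ↔ T.Open_thetaGen12 := by
  constructor
  · intro h L ι₁ V c hc Γ ω₁ ω₂ h₁ h₂
    rw [(T.t12 V c).S12_eq_allChars (h12 V c), TorusData.allChars_S12]
    exact h V c hc Γ ω₁ ω₂ h₁ h₂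
  · exact T.thetaGen12All_of

/-! ### The seven all-characters inputs -/

/-- **The SEVEN non-design inputs of the all-characters END STATE**: `NonDesignInputs` with `chars` GONE, `thetaGen12`
for `S₁₂^all` and `thetaReal34` for every character; `embCover`, `innerEmb`, `thetaSub`, `thetaWedge`, `occ` VERBATIM
(LEMMAS.md nodes: [PRINT] ×2, N12, N33, N19w^all, N19g^all, N29). -/
structure AllCharsNonDesign : Prop where
  embCover : T.Fact_embCover
  innerEmb : T.Fact_innerEmb
  thetaSub : T.Open_thetaSub
  thetaWedge : T.Open_thetaWedge
  thetaGen12All : T.Open_thetaGen12All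
  thetaReal34All : T.Open_thetaReal34All
  occ : T.Open_occ

/-- The eight non-design inputs of `T.allChars` ARE the seven all-characters inputs of `T`. -/
theorem allChars_nonDesignInputs_iff : T.allChars.NonDesignInputs ↔ T.AllCharsNonDesign :=
  ⟨fun A => ⟨A.embCover, A.innerEmb, (T.allChars_thetaSub_iff).mp A.thetaSub,
      (T.allChars_thetaWedge_iff).mp A.thetaWedge, (T.allChars_thetaGen12_iff).mp A.thetaGen12,
      (T.allChars_thetaReal34_iff).mp A.thetaReal34, (T.allChars_occ_iff).mp A.occ⟩,
    fun A => ⟨A.embCover, A.innerEmb, (T.allChars_thetaSub_iff).mpr A.thetaSub,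
      (T.allChars_thetaWedge_iff).mpr A.thetaWedge, (T.allChars_thetaGen12_iff).mpr A.thetaGen12All,
      (T.allChars_thetaReal34_iff).mpr A.thetaReal34All, T.allChars_chars, (T.allChars_occ_iff).mpr A.occ⟩⟩

/-- The ten inputs of `T.allChars` are the seven all-characters inputs and the two design constraints of `T`. -/
theorem allChars_inputs_iff :
    T.allChars.Inputs ↔ T.AllCharsNonDesign ∧ T.Design_kappaConj ∧ T.Design_frameSignConj :=
  ⟨fun A => ⟨(T.allChars_nonDesignInputs_iff).mp A.toNonDesign, A.kappaConj, A.frameSignConj⟩,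
    fun ⟨A, hκ, hs⟩ => ((T.allChars_nonDesignInputs_iff).mpr A).toInputs hκ hs⟩

/-- **MONOTONICITY.** For every theta model the eight non-design inputs of record imply the seven all-characters
inputs (`chars` is used exactly once: to pass from N19g-for-allowed-`χ` to N19g-for-all-`χ`). -/
theorem NonDesignInputs.allChars {T : U.ThetaModel} (A : T.NonDesignInputs) : T.AllCharsNonDesign :=
  ⟨A.embCover, A.innerEmb, A.thetaSub, A.thetaWedge, T.thetaGen12All_of A.thetaGen12,
    T.thetaReal34All_of A.thetaReal34 A.chars, A.occ⟩

/-- The ten inputs of record give the ten inputs of `T.allChars`. -/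
theorem Inputs.allChars {T : U.ThetaModel} (A : T.Inputs) : T.allChars.Inputs :=
  (T.allChars_inputs_iff).mpr ⟨A.toNonDesign.allChars, A.kappaConj, A.frameSignConj⟩

/-- For a theta model all of whose characters are allowed, the eight inputs of record and the seven all-characters
inputs are EQUIVALENT. -/
theorem nonDesignInputs_iff_allChars_of_allowed
    (h12 : ∀ {L : CMField} {ι₁ : L →+* ℂ} (V : HermSpace3 L ι₁) (c : SeesawCtx L) (χ : (T.t12 V c).X),
      (T.t12 V c).allowed χ)
    (h34 : ∀ {L : CMField} {ι₁ : L →+* ℂ} (V : HermSpace3 L ι₁) (c : SeesawCtx L) (χ : (T.t34 V c).X),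
      (T.t34 V c).allowed χ) :
    T.NonDesignInputs ↔ T.AllCharsNonDesign := by
  refine ⟨NonDesignInputs.allChars, fun A => ⟨A.embCover, A.innerEmb, A.thetaSub, A.thetaWedge,
    (T.thetaGen12All_iff_of_allowed h12).mp A.thetaGen12All, T.thetaReal34_of_all A.thetaReal34All, ?_, A.occ⟩⟩
  intro L ι₁ V c _
  exact ⟨h12 V c, h34 V c⟩

/-! ### END STATES over an arbitrary theta model -/

/-- **Both realisation inputs from the SEVEN all-characters inputs** (+ the model facts, the two design
constraints of `T`, Hodge–Riemann): `realisationExists_of''` at `T.allChars`. -/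
theorem realisationExists_allChars (M : U.ModelAxioms) (A : T.AllCharsNonDesign) (hκ : T.Design_kappaConj)
    (hs : T.Design_frameSignConj) (hHR : U.Fact_hodgeRiemann20) :
    U.RealisationExistsPerL ∧ U.RealisationExistsFace :=
  T.allChars.realisationExists_of'' M ((T.allChars_inputs_iff).mpr ⟨A, hκ, hs⟩) hHR

/-- **PerL from the seven all-characters inputs.** -/
theorem perL_allChars (M : U.ModelAxioms) (A : T.AllCharsNonDesign) (hκ : T.Design_kappaConj)
    (hs : T.Design_frameSignConj) (hHR : U.Fact_hodgeRiemann20) : U.PerL :=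
  Assembly.perL_theta'' U M T.allChars ((T.allChars_inputs_iff).mpr ⟨A, hκ, hs⟩) hHR

/-- **COR-CM, END STATE from the seven all-characters inputs.** -/
theorem COR_CM_endState_allChars (M : U.ModelAxioms) (h29 : U.Fact_weightSpan) (h30 : U.Fact_weightHodge)
    (hE : U.Qw8ExtProd) (hD : U.Qw8DualPushPull) (hMi : U.Qw8Milne) (A : T.AllCharsNonDesign)
    (hκ : T.Design_kappaConj) (hs : T.Design_frameSignConj) (hHR : U.Fact_hodgeRiemann20) : U.HC_CM :=
  Assembly.COR_CM_endState U M h29 h30 hE hD hMi T.allChars ((T.allChars_inputs_iff).mpr ⟨A, hκ, hs⟩) hHR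

/-- Sign-recipe form: a theta model whose `κ` / frame sign ARE PerL's recipe needs only the seven all-characters
inputs. -/
theorem realisationExists_allChars_ofSignRecipe (M : U.ModelAxioms) (h : Bool)
    (hk : T.kappa = SignRecipe.kappa h) (hf : T.frameSign = SignRecipe.frameSign) (A : T.AllCharsNonDesign)
    (hHR : U.Fact_hodgeRiemann20) : U.RealisationExistsPerL ∧ U.RealisationExistsFace :=
  T.realisationExists_allChars M A (T.design_kappaConj_of_eq h hk) (T.design_frameSignConj_of_eq hf) hHR

/-- The END STATE over the inputs of record factors through the all-characters one. -/
theorem realisationExists_of_viaAllChars (M : U.ModelAxioms) (A : T.Inputs) (hHR : U.Fact_hodgeRiemann20) :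
    U.RealisationExistsPerL ∧ U.RealisationExistsFace :=
  T.realisationExists_allChars M A.toNonDesign.allChars A.kappaConj A.frameSignConj hHR

end ThetaModel

/-! ## The adelic END STATE: side DATA = archimedean type only -/

/-- **The archimedean type of a torus side** — the pair `(m₁, m₂)` of the weight `w = χ_∞` (PerL l. 424); with every
character allowed this is ALL the data of a side. -/
structure SideArchType (L : Type) [Field L] [NumberField L] [IsCMField L] where
  /-- archimedean type on the first factor -/
  m₁ : InfinitePlace L → ℤ
  /-- archimedean type on the second factor -/
  m₂ : InfinitePlace L → ℤ


-- port_pkg: scope closed for this part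
end Universe
end HodgeCM
end
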